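import Summits.HodgeConjecture.HodgeConjecture.Theorems.F0P3cStCharTSHorient                 -- ★ p849911 HORIENT (LH1-p03 (g2)): `valued_diag_eq_one_of_mem_level`, `localNonsplitEquiv_endoEmbLocal_apply_zero∕two`; brings KIT-B, `endoEmbLocal`, ★ `coe_localNonsplitEquiv_eq_map`
import Literature.NumberTheory.Automorphic.UnitaryGroupLineUnipotentRing                     -- ★ `LineRing.torus_relations_two` (`σ(d₀) d₁ = 1` on `T₂`)
import Literature.NumberTheory.Rogawski1990.ExplicitFactorKappaAlmostEverywhereOne            -- ★ `conjLocal_apply_eq_galAdicCompletionMap` (`((c ⊗ 1) x)_w = σ_w (x_w)`)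
import Literature.NumberTheory.Rogawski1990.FinExplicitTransferFactorInertPlaceValuation      -- ★ `valued_finGammaTwo_apply_eq_one` (the `U(Φ₁)`-coordinate is a `w`-unit)
import HarnessLib

/-!
# F0 · P3c · line LH6 «StCharTS» — road (D) «DEEP-FL», brick «REP-HYPERBOLIC★»: the representatives of the ORIENTED shell cover are hlevi-oriented hyperbolic

Cell `pub/hodgecm-mathlib`, crux H413 = `stmt-HodgeConjecture-24833` (lane `--supports … --as helper`), route HCCMUnconditional; hand F0P3-p01 (g20) on the
road-(D) owner's deal (LH6-p04 (g3), 2026-09-02 06:57Z «TAKE REP-HYPERBOLIC★»).  THEOREMS ONLY, sorry-free, ★-only imports; no definition ∕ instance ∕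
notation ∕ named fact.  HONEST LABEL: HC_CM is proved only modulo the 7 printed citations (2 remaining: hLiu418 = stmt-HodgeConjecture-24832, h413 =
stmt-HodgeConjecture-24833) until rung 0 closes; count-neutral plumbing for the (D-c) head «XIG-ASSEMBLY» (the head's READING OF THE REPRESENTATIVES of ★ p849867
`F0P3cStCharTSCosetCover.exists_cosetCover`, conjunct ①).

THE MATHEMATICS ([Rogawski1990, §4.9 Lemma 4.9.2, (4.9.4) p. 56; §12.7 L. 12.7.3 (proof) p. 195]).  `v` non-split, `w ∣ v` the place above, `E₃ ∕ E₂` the one-place models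
(matrix = `w`-component of the `∏_{w∣v} L_w`-matrix, ★ `coe_localNonsplitEquiv_eq_map`).  ORIENTED SHELL: `B₂ = b′·S_n ⊆ T₃` with `E₃ b′ = diag(e₀, e₁, e₂)`, `|e₂|_w < |e₀|_w`
(for the flip of `z·𝓘.a^m`: `e = (β(σ_w α)⁻ᵐ, β, βαᵐ)`, ★ HORIENT `valued_lt_of_endoEmbLocal_eq_flip_mul`), `S_n ≤ T₃` inside a level subgroup `K_n` (`|E₃(k)ᵢⱼ − δᵢⱼ|_w ≤ r < 1`).
If a representative `x = (x₁, x₂) ∈ T₂ × U(Φ₁)_v` of the coset cover is COVERED, i.e. `ι_v(x₁, x₂) = t ∈ b′·S_n` (conjunct ① of ★ `exists_cosetCover`), then with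
`x₁ = diag(d′₀, d′₁)` (`T₂` is the diagonal torus, ★ `mem_torusU_iff`): `E₃(t)₀₀ = (d′₀)_w`, `E₃(t)₂₂ = (d′₁)_w` (★ HORIENT), while `E₃(t) = E₃(b′)·E₃(s)` has diagonal
`(e₀ k₀₀, e₁ k₁₁, e₂ k₂₂)` with `|kᵢᵢ|_w = 1`; hence **`|(d′₁)_w|_w = |e₂| < |e₀| = |(d′₀)_w|_w`** — the representative's `U(Φ₂)`-part is an hlevi-ORIENTED hyperbolic diagonal
(the `hlt` binder of ★ KIT-B), and the torus relation `σ(d′₀) d′₁ = 1` of `T₂ ≤ U(Φ₂)` (★ `LineRing.torus_relations_two`) read at `w` is the `h01` binder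
`σ_w((d′₀)_w) · (d′₁)_w = 1` (so `|(d′₀)_w|·|(d′₁)_w| = 1`).  In `E₂`-coordinates: `E₂ x₁ = diag(d₀, d₁)` with `|d₁| < |d₀|`, `|d₀|·|d₁| = 1` — the SHELL-ON `hu ∕ hne ∕ hprod`
shape (★ `F0P3cStCharTSOffStratumCM`) — and the `U(Φ₁)`-coordinate is a `w`-unit (★ `valued_finGammaTwo_apply_eq_one`).  So the Weyl flip of `x₁` is `H`-DOMINANT.

* §1 torus bookkeeping on `T₂`: `conj_apply_mul_apply_eq_one_of_glDiagonal_eq` (`h01`), `valued_apply_mul_valued_apply_eq_one_of_glDiagonal_eq`,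
  `localNonsplitEquiv_two_eq_diagonal_of_glDiagonal_eq` (`E₂ x₁ = diag((d′₀)_w, (d′₁)_w)`);
* §2 the oriented shell: `localNonsplitEquiv_smul_apply` (`E₃(b′·s)ᵢᵢ = eᵢ · E₃(s)ᵢᵢ`), **`valued_lt_of_mem_orientedShell`** (`hlt` for a covered representative, ∀ `d′`),
  **`exists_glDiagonal_of_mem_orientedShell`** (KIT-B shape `∃ d′, hd′ ∧ hlt ∧ h01`), **`exists_localNonsplitEquiv_two_eq_diagonal_of_mem_orientedShell`** (`E₂`∕SHELL-ON shape
  + the `U(Φ₁)` unit);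
* §3 over the cover: **`forall_rep_hyperbolic_of_cover`** — for `F` with conjunct ① of ★ `exists_cosetCover`, every `u ∈ F` satisfies §2's conclusions.

## References
* [Rogawski1990] J. D. Rogawski, *Automorphic Representations of Unitary Groups in Three Variables*, Ann. of Math. Stud. 123 (1990): §1.10 p. 9 (`M = {d(α, β, ᾱ⁻¹)}`);
  §4.9 Lemma 4.9.2, (4.9.4) pp. 55–56; §12.7 Lemma 12.7.3 (proof) p. 195.
* [Casselman1995] W. Casselman, *Introduction to the theory of admissible representations of 𝔭-adic reductive groups* (1995 notes), §1.4 (contracting elements, shells).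
-/

set_option autoImplicit false
-- the mandated namespace has the single-problem summit's repeated segment (`HodgeConjecture.HodgeConjecture`)
set_option linter.dupNamespace false

noncomputable section

open Matrix NumberField IsDedekindDomain
open scoped MatrixGroups Pointwise
open Literature.NumberTheory.Rogawski1990 Literature.NumberTheory.Automorphic Literature.NumberTheory.Automorphic.UnitaryGroup
open Literature.NumberTheory.GaloisRepresentations
open Summit.HodgeConjecture.HodgeConjecture.Cruxes.H413.F0P3cStCharTSHorient

namespace Summit.HodgeConjecture.HodgeConjecture.Cruxes.H413.F0P3cStCharTSRepHyperbolic

variable (L : Type) [Field L] [NumberField L] [IsCMField L] (v : HeightOneSpectrum (𝓞 ↥(maximalRealSubfield L)))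
  (w : PlacesOver L v) (hw : IsCMField.complexConj L • w.1 = w.1)

/-! ## §1 Torus bookkeeping on `T₂ ≤ U(Φ₂)(L⁺_v)` -/

include hw in
/-- **`h01` for ANY element of `T₂`**: `x₁ = diag(d′₀, d′₁) ∈ T₂` has `σ_w((d′₀)_w) · (d′₁)_w = 1` (the torus relation `σ(d′₀) d′₁ = 1` of ★ `LineRing.torus_relations_two`, read at `w` by
★ `conjLocal_apply_eq_galAdicCompletionMap`). [cite: Rogawski1990, §1.10 p. 9] -/
theorem conj_apply_mul_apply_eq_one_of_glDiagonal_eq (x₁ : ↥(cmBorelTriple L 2 v).M) {d' : Fin 2 → (LocalRing L v)ˣ}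
    (hd' : glDiagonal 2 (LocalRing L v) d' = ((x₁ : ↥(unitaryGroupOfForm (conjLocal L (IsCMField.complexConj L) v) (cmLocalForm L 2 v))) : GL (Fin 2) (LocalRing L v))) :
    galAdicCompletionMap (L := L) (IsCMField.complexConj L) hw (((d' 0 : (LocalRing L v)ˣ) : LocalRing L v) w) * ((d' 1 : (LocalRing L v)ˣ) : LocalRing L v) w = 1 := by
  obtain ⟨-, h01⟩ := LineRing.torus_relations_two (conjLocal L (IsCMField.complexConj L) v) (cmLocalForm_eq_over L 2 v) x₁ hd'
  have h := congrArg (fun y : LocalRing L v => y w) h01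
  simp only [Pi.mul_apply, Pi.one_apply] at h
  rwa [conjLocal_apply_eq_galAdicCompletionMap L v w hw] at h

include hw in
/-- … hence `|(d′₀)_w|_w · |(d′₁)_w|_w = 1` (`|σ_w y| = |y|`, ★ `valued_galAdicCompletionMap`). [cite: Rogawski1990, §1.10 p. 9] -/
theorem valued_apply_mul_valued_apply_eq_one_of_glDiagonal_eq (x₁ : ↥(cmBorelTriple L 2 v).M) {d' : Fin 2 → (LocalRing L v)ˣ}
    (hd' : glDiagonal 2 (LocalRing L v) d' = ((x₁ : ↥(unitaryGroupOfForm (conjLocal L (IsCMField.complexConj L) v) (cmLocalForm L 2 v))) : GL (Fin 2) (LocalRing L v))) :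
    Valued.v (((d' 0 : (LocalRing L v)ˣ) : LocalRing L v) w) * Valued.v (((d' 1 : (LocalRing L v)ˣ) : LocalRing L v) w) = 1 := by
  have h := congrArg (fun y : w.1.adicCompletion L => Valued.v y) (conj_apply_mul_apply_eq_one_of_glDiagonal_eq L v w hw x₁ hd')
  simpa only [map_mul, valued_galAdicCompletionMap, map_one] using h

/-- **`E₂ x₁ = diag((d′₀)_w, (d′₁)_w)`** for `x₁ = diag(d′₀, d′₁) ∈ T₂` (★ `coe_localNonsplitEquiv_eq_map`: the one-place matrix is the `w`-component).
[cite: Rogawski1990, §1.10 p. 9; §4.9 p. 55] -/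
theorem localNonsplitEquiv_two_eq_diagonal_of_glDiagonal_eq (x₁ : ↥(cmBorelTriple L 2 v).M) {d' : Fin 2 → (LocalRing L v)ˣ}
    (hd' : glDiagonal 2 (LocalRing L v) d' = ((x₁ : ↥(unitaryGroupOfForm (conjLocal L (IsCMField.complexConj L) v) (cmLocalForm L 2 v))) : GL (Fin 2) (LocalRing L v))) :
    (((localNonsplitEquiv (IsCMField.complexConj L) (Matrix.of fun i j : Fin 2 => if i.val + j.val + 1 = 2 then (1 : L) else 0) (IsCMField.complexConj_ne_one L) w hw
          (x₁ : ↥(unitaryGroupOfForm (conjLocal L (IsCMField.complexConj L) v) (cmLocalForm L 2 v))) :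
        ↥(unitaryGroupOfForm (galAdicCompletionMap (L := L) (IsCMField.complexConj L) hw) (placeForm (Matrix.of fun i j : Fin 2 => if i.val + j.val + 1 = 2 then (1 : L) else 0) w.1))) :
        GL (Fin 2) (w.1.adicCompletion L)) : Matrix (Fin 2) (Fin 2) (w.1.adicCompletion L)) =
      Matrix.diagonal ![((d' 0 : (LocalRing L v)ˣ) : LocalRing L v) w, ((d' 1 : (LocalRing L v)ˣ) : LocalRing L v) w] := by
  rw [coe_localNonsplitEquiv_eq_map]
  change (((x₁ : ↥(unitaryGroupOfForm (conjLocal L (IsCMField.complexConj L) v) (cmLocalForm L 2 v))) : GL (Fin 2) (LocalRing L v)) :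
      Matrix (Fin 2) (Fin 2) (LocalRing L v)).map (Pi.evalRingHom (fun w' : PlacesOver L v => w'.1.adicCompletion L) w) = _
  rw [← hd', coe_glDiagonal, Matrix.diagonal_map (map_zero _)]
  congr 1
  funext k
  fin_cases k <;> rfl

/-! ## §2 A representative covered by the ORIENTED shell is hlevi-oriented hyperbolic -/

/-- **`E₃`-DIAGONAL ON THE SHELL `b′·S_n`**: with `E₃ b′ = diag(e₀, e₁, e₂)`, `E₃(b′ s)ᵢᵢ = eᵢ · E₃(s)ᵢᵢ`. [cite: Rogawski1990, §12.7 L. 12.7.3 (proof) p. 195] -/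
theorem localNonsplitEquiv_mul_apply_of_eq_diagonal
    {b' : ↥(unitaryGroupOfForm (conjLocal L (IsCMField.complexConj L) v) (cmLocalForm L 3 v))} {e : Fin 3 → w.1.adicCompletion L}
    (hb' : (((localNonsplitEquiv (IsCMField.complexConj L) (qsForm L) (IsCMField.complexConj_ne_one L) w hw b' :
        ↥(unitaryGroupOfForm (galAdicCompletionMap (L := L) (IsCMField.complexConj L) hw) (placeForm (qsForm L) w.1))) :
        GL (Fin 3) (w.1.adicCompletion L)) : Matrix (Fin 3) (Fin 3) (w.1.adicCompletion L)) = Matrix.diagonal e)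
    (s : ↥(unitaryGroupOfForm (conjLocal L (IsCMField.complexConj L) v) (cmLocalForm L 3 v))) (i : Fin 3) :
    (((localNonsplitEquiv (IsCMField.complexConj L) (qsForm L) (IsCMField.complexConj_ne_one L) w hw (b' * s) :
        ↥(unitaryGroupOfForm (galAdicCompletionMap (L := L) (IsCMField.complexConj L) hw) (placeForm (qsForm L) w.1))) :
        GL (Fin 3) (w.1.adicCompletion L)) : Matrix (Fin 3) (Fin 3) (w.1.adicCompletion L)) i i =
      e i * (((localNonsplitEquiv (IsCMField.complexConj L) (qsForm L) (IsCMField.complexConj_ne_one L) w hw s :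
          ↥(unitaryGroupOfForm (galAdicCompletionMap (L := L) (IsCMField.complexConj L) hw) (placeForm (qsForm L) w.1))) :
          GL (Fin 3) (w.1.adicCompletion L)) : Matrix (Fin 3) (Fin 3) (w.1.adicCompletion L)) i i := by
  have hb'' : (((b'.val : GL (Fin 3) (LocalRing L v)) : Matrix (Fin 3) (Fin 3) (LocalRing L v)).map
      (Pi.evalRingHom (fun w' : PlacesOver L v => w'.1.adicCompletion L) w)) = Matrix.diagonal e := hb'
  rw [coe_localNonsplitEquiv_eq_map, coe_localNonsplitEquiv_eq_map, Subgroup.coe_mul, Units.val_mul, Matrix.map_mul, hb'', Matrix.diagonal_mul]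

include hw in
/-- **«REP-HYPERBOLIC★», `hlt` FORM (∀ `d′`).**  `K_n` of level `r < 1` at `w`; the ORIENTED shell base `b′ ∈ T₃` with `E₃ b′ = diag(e₀, e₁, e₂)`, `|e₂|_w < |e₀|_w`; `S_n ≤ T₃`
inside `K_n`.  If `x = (x₁, x₂) ∈ T₂ × U(Φ₁)_v` is COVERED (`ι_v(x₁, x₂) = t ∈ b′·S_n`) and `x₁ = diag(d′₀, d′₁)`, then `|(d′₁)_w|_w < |(d′₀)_w|_w` — the representative is
hlevi-ORIENTED. [cite: Rogawski1990, §4.9 Lemma 4.9.2, (4.9.4) p. 56; §12.7 L. 12.7.3 (proof) p. 195] [cite: Casselman1995, §1.4] -/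
theorem valued_lt_of_mem_orientedShell
    (Kn : Subgroup ↥(unitaryGroupOfForm (conjLocal L (IsCMField.complexConj L) v) (cmLocalForm L 3 v))) {r : WithZero (Multiplicative ℤ)} (hr : r < 1)
    (hK : ∀ k ∈ Kn, ∀ i j, Valued.v ((((localNonsplitEquiv (IsCMField.complexConj L) (qsForm L) (IsCMField.complexConj_ne_one L) w hw k :
        ↥(unitaryGroupOfForm (galAdicCompletionMap (L := L) (IsCMField.complexConj L) hw) (placeForm (qsForm L) w.1))) :
        GL (Fin 3) (w.1.adicCompletion L)) : Matrix (Fin 3) (Fin 3) (w.1.adicCompletion L)) i j - (1 : Matrix (Fin 3) (Fin 3) (w.1.adicCompletion L)) i j) ≤ r)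
    {b' : ↥(cmBorelTriple L 3 v).M} {e₀ e₁ e₂ : w.1.adicCompletion L}
    (hb' : (((localNonsplitEquiv (IsCMField.complexConj L) (qsForm L) (IsCMField.complexConj_ne_one L) w hw
          (b' : ↥(unitaryGroupOfForm (conjLocal L (IsCMField.complexConj L) v) (cmLocalForm L 3 v))) :
        ↥(unitaryGroupOfForm (galAdicCompletionMap (L := L) (IsCMField.complexConj L) hw) (placeForm (qsForm L) w.1))) :
        GL (Fin 3) (w.1.adicCompletion L)) : Matrix (Fin 3) (Fin 3) (w.1.adicCompletion L)) = Matrix.diagonal ![e₀, e₁, e₂])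
    (he : Valued.v e₂ < Valued.v e₀)
    (Sn : Subgroup ↥(cmBorelTriple L 3 v).M)
    (hSn : ∀ s ∈ Sn, ((s : ↥(cmBorelTriple L 3 v).M) : ↥(unitaryGroupOfForm (conjLocal L (IsCMField.complexConj L) v) (cmLocalForm L 3 v))) ∈ Kn)
    (x : ↥(cmBorelTriple L 2 v).M × (cmDatum L 1 (Matrix.of fun i j : Fin 1 => if i.val + j.val + 1 = 1 then (1 : L) else 0)).Local v)
    {t : ↥(cmBorelTriple L 3 v).M} (ht : t ∈ b' • (Sn : Set ↥(cmBorelTriple L 3 v).M))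
    (hxt : (t : ↥(unitaryGroupOfForm (conjLocal L (IsCMField.complexConj L) v) (cmLocalForm L 3 v))) =
      endoEmbLocal L v ((x.1 : ↥(unitaryGroupOfForm (conjLocal L (IsCMField.complexConj L) v) (cmLocalForm L 2 v))), x.2))
    {d' : Fin 2 → (LocalRing L v)ˣ}
    (hd' : glDiagonal 2 (LocalRing L v) d' = ((x.1 : ↥(unitaryGroupOfForm (conjLocal L (IsCMField.complexConj L) v) (cmLocalForm L 2 v))) : GL (Fin 2) (LocalRing L v))) :
    Valued.v (((d' 1 : (LocalRing L v)ˣ) : LocalRing L v) w) < Valued.v (((d' 0 : (LocalRing L v)ˣ) : LocalRing L v) w) := by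
  obtain ⟨s, hs, rfl⟩ := Set.mem_smul_set.1 ht
  -- the `hlevi` pair `γ_H = (x₁, x₂)` and its frame `d′`
  have hd'' : glDiagonal 2 (LocalRing L v) d' =
      ((((x.1 : ↥(unitaryGroupOfForm (conjLocal L (IsCMField.complexConj L) v) (cmLocalForm L 2 v))), x.2) :
        (cmDatum L 2 (Matrix.of fun i j : Fin 2 => if i.val + j.val + 1 = 2 then (1 : L) else 0)).Local v ×
          (cmDatum L 1 (Matrix.of fun i j : Fin 1 => if i.val + j.val + 1 = 1 then (1 : L) else 0)).Local v).1.val : GL (Fin 2) (LocalRing L v)) := hd'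
  have h0 := localNonsplitEquiv_endoEmbLocal_apply_zero L v w hw _ hd''
  have h2 := localNonsplitEquiv_endoEmbLocal_apply_two L v w hw _ hd''
  rw [← hxt] at h0 h2
  change (((localNonsplitEquiv (IsCMField.complexConj L) (qsForm L) (IsCMField.complexConj_ne_one L) w hw
      ((b' : ↥(unitaryGroupOfForm (conjLocal L (IsCMField.complexConj L) v) (cmLocalForm L 3 v))) *
        ((s : ↥(cmBorelTriple L 3 v).M) : ↥(unitaryGroupOfForm (conjLocal L (IsCMField.complexConj L) v) (cmLocalForm L 3 v)))) : _) :
      GL (Fin 3) (w.1.adicCompletion L)) : Matrix (Fin 3) (Fin 3) (w.1.adicCompletion L)) 0 0 = _ at h0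
  change (((localNonsplitEquiv (IsCMField.complexConj L) (qsForm L) (IsCMField.complexConj_ne_one L) w hw
      ((b' : ↥(unitaryGroupOfForm (conjLocal L (IsCMField.complexConj L) v) (cmLocalForm L 3 v))) *
        ((s : ↥(cmBorelTriple L 3 v).M) : ↥(unitaryGroupOfForm (conjLocal L (IsCMField.complexConj L) v) (cmLocalForm L 3 v)))) : _) :
      GL (Fin 3) (w.1.adicCompletion L)) : Matrix (Fin 3) (Fin 3) (w.1.adicCompletion L)) 2 2 = _ at h2
  rw [localNonsplitEquiv_mul_apply_of_eq_diagonal L v w hw hb'] at h0 h2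
  simp only [Matrix.cons_val_zero, Matrix.cons_val_two, Matrix.tail_cons, Matrix.head_cons] at h0 h2
  rw [← h0, ← h2, map_mul, map_mul, valued_diag_eq_one_of_mem_level L v w hw Kn hr hK (hSn s hs) 0,
    valued_diag_eq_one_of_mem_level L v w hw Kn hr hK (hSn s hs) 2, mul_one, mul_one]
  exact he

include hw in
/-- **«REP-HYPERBOLIC★», KIT-B SHAPE (`∃ d′`, `hd′ ∧ hlt ∧ h01`)** for a covered representative `x = (x₁, x₂)` of the oriented shell.
[cite: Rogawski1990, §4.9 Lemma 4.9.2, (4.9.4) p. 56; §12.7 L. 12.7.3 (proof) p. 195] -/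
theorem exists_glDiagonal_of_mem_orientedShell
    (Kn : Subgroup ↥(unitaryGroupOfForm (conjLocal L (IsCMField.complexConj L) v) (cmLocalForm L 3 v))) {r : WithZero (Multiplicative ℤ)} (hr : r < 1)
    (hK : ∀ k ∈ Kn, ∀ i j, Valued.v ((((localNonsplitEquiv (IsCMField.complexConj L) (qsForm L) (IsCMField.complexConj_ne_one L) w hw k :
        ↥(unitaryGroupOfForm (galAdicCompletionMap (L := L) (IsCMField.complexConj L) hw) (placeForm (qsForm L) w.1))) :
        GL (Fin 3) (w.1.adicCompletion L)) : Matrix (Fin 3) (Fin 3) (w.1.adicCompletion L)) i j - (1 : Matrix (Fin 3) (Fin 3) (w.1.adicCompletion L)) i j) ≤ r)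
    {b' : ↥(cmBorelTriple L 3 v).M} {e₀ e₁ e₂ : w.1.adicCompletion L}
    (hb' : (((localNonsplitEquiv (IsCMField.complexConj L) (qsForm L) (IsCMField.complexConj_ne_one L) w hw
          (b' : ↥(unitaryGroupOfForm (conjLocal L (IsCMField.complexConj L) v) (cmLocalForm L 3 v))) :
        ↥(unitaryGroupOfForm (galAdicCompletionMap (L := L) (IsCMField.complexConj L) hw) (placeForm (qsForm L) w.1))) :
        GL (Fin 3) (w.1.adicCompletion L)) : Matrix (Fin 3) (Fin 3) (w.1.adicCompletion L)) = Matrix.diagonal ![e₀, e₁, e₂])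
    (he : Valued.v e₂ < Valued.v e₀)
    (Sn : Subgroup ↥(cmBorelTriple L 3 v).M)
    (hSn : ∀ s ∈ Sn, ((s : ↥(cmBorelTriple L 3 v).M) : ↥(unitaryGroupOfForm (conjLocal L (IsCMField.complexConj L) v) (cmLocalForm L 3 v))) ∈ Kn)
    (x : ↥(cmBorelTriple L 2 v).M × (cmDatum L 1 (Matrix.of fun i j : Fin 1 => if i.val + j.val + 1 = 1 then (1 : L) else 0)).Local v)
    {t : ↥(cmBorelTriple L 3 v).M} (ht : t ∈ b' • (Sn : Set ↥(cmBorelTriple L 3 v).M))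
    (hxt : (t : ↥(unitaryGroupOfForm (conjLocal L (IsCMField.complexConj L) v) (cmLocalForm L 3 v))) =
      endoEmbLocal L v ((x.1 : ↥(unitaryGroupOfForm (conjLocal L (IsCMField.complexConj L) v) (cmLocalForm L 2 v))), x.2)) :
    ∃ d' : Fin 2 → (LocalRing L v)ˣ,
      glDiagonal 2 (LocalRing L v) d' = ((x.1 : ↥(unitaryGroupOfForm (conjLocal L (IsCMField.complexConj L) v) (cmLocalForm L 2 v))) : GL (Fin 2) (LocalRing L v)) ∧
      Valued.v (((d' 1 : (LocalRing L v)ˣ) : LocalRing L v) w) < Valued.v (((d' 0 : (LocalRing L v)ˣ) : LocalRing L v) w) ∧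
      galAdicCompletionMap (L := L) (IsCMField.complexConj L) hw (((d' 0 : (LocalRing L v)ˣ) : LocalRing L v) w) * ((d' 1 : (LocalRing L v)ˣ) : LocalRing L v) w = 1 := by
  obtain ⟨d', hd'⟩ := (mem_torusU_iff _).1 x.1.2
  exact ⟨d', hd', valued_lt_of_mem_orientedShell L v w hw Kn hr hK hb' he Sn hSn x ht hxt hd', conj_apply_mul_apply_eq_one_of_glDiagonal_eq L v w hw x.1 hd'⟩

include hw in
/-- **«REP-HYPERBOLIC★», `E₂` ∕ SHELL-ON SHAPE** for a covered representative `x = (x₁, x₂)`: `E₂ x₁ = diag(d₀, d₁)` with `|d₁|_w < |d₀|_w`, `|d₀|_w·|d₁|_w = 1`, `σ_w(d₀)·d₁ = 1`,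
and the `U(Φ₁)`-coordinate is a `w`-unit (★ `valued_finGammaTwo_apply_eq_one`). [cite: Rogawski1990, §4.9 Lemma 4.9.2, (4.9.4) pp. 55–56; §12.7 L. 12.7.3 (proof) p. 195] -/
theorem exists_localNonsplitEquiv_two_eq_diagonal_of_mem_orientedShell
    (Kn : Subgroup ↥(unitaryGroupOfForm (conjLocal L (IsCMField.complexConj L) v) (cmLocalForm L 3 v))) {r : WithZero (Multiplicative ℤ)} (hr : r < 1)
    (hK : ∀ k ∈ Kn, ∀ i j, Valued.v ((((localNonsplitEquiv (IsCMField.complexConj L) (qsForm L) (IsCMField.complexConj_ne_one L) w hw k :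
        ↥(unitaryGroupOfForm (galAdicCompletionMap (L := L) (IsCMField.complexConj L) hw) (placeForm (qsForm L) w.1))) :
        GL (Fin 3) (w.1.adicCompletion L)) : Matrix (Fin 3) (Fin 3) (w.1.adicCompletion L)) i j - (1 : Matrix (Fin 3) (Fin 3) (w.1.adicCompletion L)) i j) ≤ r)
    {b' : ↥(cmBorelTriple L 3 v).M} {e₀ e₁ e₂ : w.1.adicCompletion L}
    (hb' : (((localNonsplitEquiv (IsCMField.complexConj L) (qsForm L) (IsCMField.complexConj_ne_one L) w hw
          (b' : ↥(unitaryGroupOfForm (conjLocal L (IsCMField.complexConj L) v) (cmLocalForm L 3 v))) :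
        ↥(unitaryGroupOfForm (galAdicCompletionMap (L := L) (IsCMField.complexConj L) hw) (placeForm (qsForm L) w.1))) :
        GL (Fin 3) (w.1.adicCompletion L)) : Matrix (Fin 3) (Fin 3) (w.1.adicCompletion L)) = Matrix.diagonal ![e₀, e₁, e₂])
    (he : Valued.v e₂ < Valued.v e₀)
    (Sn : Subgroup ↥(cmBorelTriple L 3 v).M)
    (hSn : ∀ s ∈ Sn, ((s : ↥(cmBorelTriple L 3 v).M) : ↥(unitaryGroupOfForm (conjLocal L (IsCMField.complexConj L) v) (cmLocalForm L 3 v))) ∈ Kn)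
    (x : ↥(cmBorelTriple L 2 v).M × (cmDatum L 1 (Matrix.of fun i j : Fin 1 => if i.val + j.val + 1 = 1 then (1 : L) else 0)).Local v)
    {t : ↥(cmBorelTriple L 3 v).M} (ht : t ∈ b' • (Sn : Set ↥(cmBorelTriple L 3 v).M))
    (hxt : (t : ↥(unitaryGroupOfForm (conjLocal L (IsCMField.complexConj L) v) (cmLocalForm L 3 v))) =
      endoEmbLocal L v ((x.1 : ↥(unitaryGroupOfForm (conjLocal L (IsCMField.complexConj L) v) (cmLocalForm L 2 v))), x.2)) :
    (∃ d₀ d₁ : w.1.adicCompletion L,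
      (((localNonsplitEquiv (IsCMField.complexConj L) (Matrix.of fun i j : Fin 2 => if i.val + j.val + 1 = 2 then (1 : L) else 0) (IsCMField.complexConj_ne_one L) w hw
            (x.1 : ↥(unitaryGroupOfForm (conjLocal L (IsCMField.complexConj L) v) (cmLocalForm L 2 v))) :
          ↥(unitaryGroupOfForm (galAdicCompletionMap (L := L) (IsCMField.complexConj L) hw) (placeForm (Matrix.of fun i j : Fin 2 => if i.val + j.val + 1 = 2 then (1 : L) else 0) w.1))) :
          GL (Fin 2) (w.1.adicCompletion L)) : Matrix (Fin 2) (Fin 2) (w.1.adicCompletion L)) = Matrix.diagonal ![d₀, d₁] ∧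
      Valued.v d₁ < Valued.v d₀ ∧ Valued.v d₀ * Valued.v d₁ = 1 ∧ galAdicCompletionMap (L := L) (IsCMField.complexConj L) hw d₀ * d₁ = 1) ∧
    Valued.v (finGammaTwo L v ((x.1 : ↥(unitaryGroupOfForm (conjLocal L (IsCMField.complexConj L) v) (cmLocalForm L 2 v))), x.2) w) = 1 := by
  obtain ⟨d', hd', hlt, h01⟩ := exists_glDiagonal_of_mem_orientedShell L v w hw Kn hr hK hb' he Sn hSn x ht hxt
  exact ⟨⟨((d' 0 : (LocalRing L v)ˣ) : LocalRing L v) w, ((d' 1 : (LocalRing L v)ˣ) : LocalRing L v) w,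
    localNonsplitEquiv_two_eq_diagonal_of_glDiagonal_eq L v w hw x.1 hd', hlt, valued_apply_mul_valued_apply_eq_one_of_glDiagonal_eq L v w hw x.1 hd', h01⟩,
    valued_finGammaTwo_apply_eq_one L v _ w hw⟩

/-! ## §3 Over the coset cover (conjunct ① of ★ `exists_cosetCover`) -/

include hw in
/-- **«REP-HYPERBOLIC★» OVER THE COVER.**  For the ORIENTED shell `b′·S_n` (`E₃ b′ = diag(e₀, e₁, e₂)`, `|e₂|_w < |e₀|_w`, `S_n ≤ T₃` inside the level-`r` subgroup `K_n`, `r < 1`)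
and ANY finite family `F ⊆ T₂ × U(Φ₁)_v` of representatives ON the shell — conjunct ① of ★ `F0P3cStCharTSCosetCover.exists_cosetCover` VERBATIM — every `u ∈ F` is
hlevi-oriented hyperbolic: KIT-B shape `∃ d′, glDiagonal d′ = ↑u.1 ∧ |(d′₁)_w| < |(d′₀)_w| ∧ σ_w((d′₀)_w)(d′₁)_w = 1`, `E₂`∕SHELL-ON shape `E₂ u.1 = diag(d₀, d₁)`, `|d₁| < |d₀|`,
`|d₀||d₁| = 1`, `σ_w d₀ · d₁ = 1`, and `|u₂|_w = 1` for the `U(Φ₁)`-coordinate. [cite: Rogawski1990, §4.9 Lemma 4.9.2, (4.9.4) pp. 55–56; §12.7 L. 12.7.3 (proof) p. 195]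
[cite: Casselman1995, §1.4] -/
theorem forall_rep_hyperbolic_of_cover
    (Kn : Subgroup ↥(unitaryGroupOfForm (conjLocal L (IsCMField.complexConj L) v) (cmLocalForm L 3 v))) {r : WithZero (Multiplicative ℤ)} (hr : r < 1)
    (hK : ∀ k ∈ Kn, ∀ i j, Valued.v ((((localNonsplitEquiv (IsCMField.complexConj L) (qsForm L) (IsCMField.complexConj_ne_one L) w hw k :
        ↥(unitaryGroupOfForm (galAdicCompletionMap (L := L) (IsCMField.complexConj L) hw) (placeForm (qsForm L) w.1))) :
        GL (Fin 3) (w.1.adicCompletion L)) : Matrix (Fin 3) (Fin 3) (w.1.adicCompletion L)) i j - (1 : Matrix (Fin 3) (Fin 3) (w.1.adicCompletion L)) i j) ≤ r)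
    {b' : ↥(cmBorelTriple L 3 v).M} {e₀ e₁ e₂ : w.1.adicCompletion L}
    (hb' : (((localNonsplitEquiv (IsCMField.complexConj L) (qsForm L) (IsCMField.complexConj_ne_one L) w hw
          (b' : ↥(unitaryGroupOfForm (conjLocal L (IsCMField.complexConj L) v) (cmLocalForm L 3 v))) :
        ↥(unitaryGroupOfForm (galAdicCompletionMap (L := L) (IsCMField.complexConj L) hw) (placeForm (qsForm L) w.1))) :
        GL (Fin 3) (w.1.adicCompletion L)) : Matrix (Fin 3) (Fin 3) (w.1.adicCompletion L)) = Matrix.diagonal ![e₀, e₁, e₂])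
    (he : Valued.v e₂ < Valued.v e₀)
    (Sn : Subgroup ↥(cmBorelTriple L 3 v).M)
    (hSn : ∀ s ∈ Sn, ((s : ↥(cmBorelTriple L 3 v).M) : ↥(unitaryGroupOfForm (conjLocal L (IsCMField.complexConj L) v) (cmLocalForm L 3 v))) ∈ Kn)
    (F : Finset (↥(cmBorelTriple L 2 v).M × (cmDatum L 1 (Matrix.of fun i j : Fin 1 => if i.val + j.val + 1 = 1 then (1 : L) else 0)).Local v))
    (hF : ∀ u ∈ F, ∃ t ∈ b' • (Sn : Set ↥(cmBorelTriple L 3 v).M),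
      (t : ↥(unitaryGroupOfForm (conjLocal L (IsCMField.complexConj L) v) (cmLocalForm L 3 v))) =
        endoEmbLocal L v ((u.1 : ↥(unitaryGroupOfForm (conjLocal L (IsCMField.complexConj L) v) (cmLocalForm L 2 v))), u.2)) :
    ∀ u ∈ F,
      (∃ d' : Fin 2 → (LocalRing L v)ˣ,
        glDiagonal 2 (LocalRing L v) d' = ((u.1 : ↥(unitaryGroupOfForm (conjLocal L (IsCMField.complexConj L) v) (cmLocalForm L 2 v))) : GL (Fin 2) (LocalRing L v)) ∧
        Valued.v (((d' 1 : (LocalRing L v)ˣ) : LocalRing L v) w) < Valued.v (((d' 0 : (LocalRing L v)ˣ) : LocalRing L v) w) ∧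
        galAdicCompletionMap (L := L) (IsCMField.complexConj L) hw (((d' 0 : (LocalRing L v)ˣ) : LocalRing L v) w) * ((d' 1 : (LocalRing L v)ˣ) : LocalRing L v) w = 1) ∧
      (∃ d₀ d₁ : w.1.adicCompletion L,
        (((localNonsplitEquiv (IsCMField.complexConj L) (Matrix.of fun i j : Fin 2 => if i.val + j.val + 1 = 2 then (1 : L) else 0) (IsCMField.complexConj_ne_one L) w hw
              (u.1 : ↥(unitaryGroupOfForm (conjLocal L (IsCMField.complexConj L) v) (cmLocalForm L 2 v))) :
            ↥(unitaryGroupOfForm (galAdicCompletionMap (L := L) (IsCMField.complexConj L) hw) (placeForm (Matrix.of fun i j : Fin 2 => if i.val + j.val + 1 = 2 then (1 : L) else 0) w.1))) :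
            GL (Fin 2) (w.1.adicCompletion L)) : Matrix (Fin 2) (Fin 2) (w.1.adicCompletion L)) = Matrix.diagonal ![d₀, d₁] ∧
        Valued.v d₁ < Valued.v d₀ ∧ Valued.v d₀ * Valued.v d₁ = 1 ∧ galAdicCompletionMap (L := L) (IsCMField.complexConj L) hw d₀ * d₁ = 1) ∧
      Valued.v (finGammaTwo L v ((u.1 : ↥(unitaryGroupOfForm (conjLocal L (IsCMField.complexConj L) v) (cmLocalForm L 2 v))), u.2) w) = 1 := by
  intro u hu
  obtain ⟨t, ht, htu⟩ := hF u hu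
  obtain ⟨hE, hU⟩ := exists_localNonsplitEquiv_two_eq_diagonal_of_mem_orientedShell L v w hw Kn hr hK hb' he Sn hSn u ht htu
  exact ⟨exists_glDiagonal_of_mem_orientedShell L v w hw Kn hr hK hb' he Sn hSn u ht htu, hE, hU⟩

end Summit.HodgeConjecture.HodgeConjecture.Cruxes.H413.F0P3cStCharTSRepHyperbolic

end
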